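import Mathlib.Algebra.Order.Chebyshev
import Literature.Analysis.FluidPDE.ElgindiNonlocalDerivatives
import HarnessLib

/-!
# Weighted `L²(dz)` bounds for the radial derivatives of the non-local part of `𝓛_Γ^T`
([Elgindi2021] §6.3 "`L₁₂` is smoothing in `θ`" / [ElgindiGhoulMasmoudi2021] §3.1 "The term with
`II` is low order")

Topic `Literature/Analysis/FluidPDE`. Proof file (everything proved, no definitions, no named
facts) on the proof path of the named fact
`Literature.Analysis.FluidPDE.Elgindi.ElgindiGhoulMasmoudi2021_stabilityCore`
(`ElgindiStabilityDecomposition.lean`). T. M. Elgindi, Ann. of Math. 194 (2021) =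
arXiv:1904.04795, §6.3 proof of Proposition 6.13 ("`L₁₂(D_θf)` and `L₁₂(f)` … can both be bounded
in `𝓗^{k−1}` by `f` in the same space"), and Elgindi–Ghoul–Masmoudi 2021, arXiv:1910.14071, §3.1
proof of Proposition 3.2 ("The term with `II` is low order and we leave it to the reader").

For a test function `f` (`C^N`, compact support inside the open strip, `L₁₂(f)(0) = 0`) and
`0 ≤ α ≤ 1/200`, the radial factors `S₁ = −(2/c)(z/(1+z)²)L₁₂(f)`, `S₂ = (2ℓ₀(f)/c)z²/(1+z)³` of the
non-local part of `𝓛_Γ^T` satisfy, for every `l`, with constants depending on `l` only: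
`∫₀^∞(D_z^lS₁)²w² dz ≤ C_l(∬(fw)² + Σ_{b<l}∬(D_z^bf·w)²)` (Leibniz, `|D_z^b(z/(1+z)²)| ≤ Cz/(1+z)²`,
`(z/(1+z)²)w = 1/z`, Hardy `∫L₁₂(f)²/z² ≤ (9π/8)∬(fw)²` and `∫(K,D_z^bf)²_θ/z² ≤ (9π/32)∬(D_z^bf·w)²`),
and `∫₀^∞(D_z^lS₂)²w² dz ≤ C_l∬(fw)²` (`|D_z^l(z²/(1+z)³)| ≤ Cz²/(1+z)³`, `ℓ₀(f)² ≤ 153∬(fw)²`,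
`∫₀^∞dz/(1+z)² = 1`): every radial derivative of the non-local terms is controlled by unweighted-in-`θ`
norms of lower `D_z`-derivatives of `f`.
-/

noncomputable section

open MeasureTheory Set Function Real Filter Finset
open _root_.Topology

namespace Literature.Analysis.FluidPDE

namespace Elgindi

/-! ### Integrability of the Hardy and moment integrands -/

/-- `z⁻²L₁₂(f)²` is integrable on `ℝ` for a test function with `L₁₂(f)(0) = 0`. [folklore] -/
theorem integrable_sq_L12_div_sq {f : ℝ → ℝ → ℝ} (hfc : Continuous (uncurry f))
    (hs : HasCompactSupport (uncurry f)) (hsub : tsupport (uncurry f) ⊆ strip) (hL0 : L12 f 0 = 0) :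
    Integrable fun z : ℝ => 1 / z ^ 2 * L12 f z ^ 2 := by
  obtain ⟨a, b, ha, -, hfab⟩ := exists_radial_bounds' hs hsub
  have hLa : ∀ z, z < a → L12 f z = 0 := fun z hz => (L12_eq_L12_zero_of_le hfc ha hfab hz.le).trans hL0
  have hLb : ∀ z, b < z → L12 f z = 0 := fun z hz => L12_eq_zero_of_le hfc ha hfab hz.le
  have hLc : Continuous (L12 f) := continuous_L12 hfc hs hsub
  have hu2 : ContinuousOn (fun z : ℝ => 1 / z ^ 2) {0}ᶜ :=
    ContinuousOn.div continuousOn_const (continuousOn_id.pow 2) fun z hz => pow_ne_zero 2 hz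
  have hLs : HasCompactSupport (L12 f) := by
    refine HasCompactSupport.intro (isCompact_Icc (a := a) (b := b)) fun z hz => ?_
    rcases not_and_or.1 (fun h => hz ⟨h.1, h.2⟩ : ¬(a ≤ z ∧ z ≤ b)) with h | h
    · exact hLa z (not_le.1 h)
    · exact hLb z (not_le.1 h)
  exact (continuous_mul_of_eq_zero_lt hu2 (hLc.pow 2) ha fun z hz => by
    simp [hLa z hz]).integrable_of_hasCompactSupport
    (HasCompactSupport.intro hLs fun z hz => by simp [image_eq_zero_of_notMem_tsupport hz])

/-- `z⁻²(K, g)²_θ` is integrable on `ℝ` for a test function `g`. [folklore] -/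
theorem integrable_sq_kMoment_div_sq {g : ℝ → ℝ → ℝ} (hgc : Continuous (uncurry g))
    (hs : HasCompactSupport (uncurry g)) (hsub : tsupport (uncurry g) ⊆ strip) :
    Integrable fun z : ℝ => 1 / z ^ 2 * kMoment g z ^ 2 := by
  obtain ⟨a, b, ha, -, hab⟩ := exists_radial_bounds' hs hsub
  have hKa : ∀ z, z < a → kMoment g z = 0 := fun z hz => kMoment_eq_zero_of_not_mem hab (Or.inl hz)
  have hKb : ∀ z, b < z → kMoment g z = 0 := fun z hz => kMoment_eq_zero_of_not_mem hab (Or.inr hz)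
  have hKc : Continuous (kMoment g) := continuous_kMoment hgc
  have hu2 : ContinuousOn (fun z : ℝ => 1 / z ^ 2) {0}ᶜ :=
    ContinuousOn.div continuousOn_const (continuousOn_id.pow 2) fun z hz => pow_ne_zero 2 hz
  have hKs : HasCompactSupport (kMoment g) := by
    refine HasCompactSupport.intro (isCompact_Icc (a := a) (b := b)) fun z hz => ?_
    rcases not_and_or.1 (fun h => hz ⟨h.1, h.2⟩ : ¬(a ≤ z ∧ z ≤ b)) with h | h
    · exact hKa z (not_le.1 h)
    · exact hKb z (not_le.1 h)
  exact (continuous_mul_of_eq_zero_lt hu2 (hKc.pow 2) ha fun z hz => by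
    simp [hKa z hz]).integrable_of_hasCompactSupport
    (HasCompactSupport.intro hKs fun z hz => by simp [image_eq_zero_of_notMem_tsupport hz])

/-- **The radial derivatives of `L₁₂(f)` in `L²(dz/z²)`**: for `m ≤ N − 2`,
`∫z⁻²(D_z^mL₁₂(f))² ≤ (9π/8)·A_m`, `A_0 = ∬(fw)²`, `A_{b+1} = ∬(D_z^bf·w)²` (Hardy for `m = 0`, the
angular Cauchy–Schwarz step for `m ≥ 1`), with integrability. [cite: Elgindi2021, §5 Lemma 5.4 (p. 15) and §6.3 (p. 18 of arXiv:1904.04795)] -/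
theorem integral_sq_iterate_Dz₁_L12_div_sq_le {f : ℝ → ℝ → ℝ} {N : ℕ} (hf : ContDiff ℝ N (uncurry f))
    (hs : HasCompactSupport (uncurry f)) (hsub : tsupport (uncurry f) ⊆ strip) (hL0 : L12 f 0 = 0)
    {m : ℕ} (hm : m + 2 ≤ N) :
    Integrable (fun z : ℝ => 1 / z ^ 2 * Dz₁^[m] (L12 f) z ^ 2) ∧
    ∫ z, 1 / z ^ 2 * Dz₁^[m] (L12 f) z ^ 2 ≤ 9 * π / 8 *
      (if m = 0 then ∫ p in strip, (f p.1 p.2 * radialWeight p.1) ^ 2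
        else ∫ p in strip, (Dz^[m - 1] f p.1 p.2 * radialWeight p.1) ^ 2) := by
  have hf2 : ContDiff ℝ 2 (uncurry f) := hf.of_le (by exact_mod_cast (by omega : 2 ≤ N))
  cases m with
  | zero =>
    simp only [Function.iterate_zero_apply, if_true]
    exact ⟨integrable_sq_L12_div_sq hf.continuous hs hsub hL0, integral_sq_L12_div_sq_le hf2 hs hsub hL0⟩
  | succ m =>
    have hfm : ContDiff ℝ m (uncurry f) := hf.of_le (by exact_mod_cast (by omega : m ≤ N))
    have e : (fun z : ℝ => 1 / z ^ 2 * Dz₁^[m + 1] (L12 f) z ^ 2) = fun z => 1 / z ^ 2 * kMoment (Dz^[m] f) z ^ 2 := by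
      funext z
      rw [iterate_Dz₁_L12 hfm hs hsub z, neg_sq]
    rw [e]
    simp only [Nat.add_sub_cancel, Nat.succ_ne_zero, if_false]
    have hg : ContDiff ℝ 2 (uncurry (Dz^[m] f)) := contDiff_iterate_Dz_of_contDiff (by
      have : ContDiff ℝ ((2 + m : ℕ) : WithTop ℕ∞) (uncurry f) := hf.of_le (by exact_mod_cast (by omega : 2 + m ≤ N))
      exact this)
    have hgs : HasCompactSupport (uncurry (Dz^[m] f)) := hasCompactSupport_iterate_Dz hs m
    have hgsub : tsupport (uncurry (Dz^[m] f)) ⊆ strip := (tsupport_iterate_Dz_subset m).trans hsub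
    exact ⟨integrable_sq_kMoment_div_sq hg.continuous hgs hgsub, (integral_sq_kMoment_div_sq_le hg hgs hgsub).trans
      (mul_le_mul_of_nonneg_right (by nlinarith [Real.pi_pos]) (integral_nonneg fun p => sq_nonneg _))⟩

/-! ### The `L₁₂`-factor `S₁` -/

/-- **`∫₀^∞(D_z^lS₁)²w² ≤ C_l(∬(fw)² + Σ_{b<l}∬(D_z^bf·w)²)`** for `0 ≤ α ≤ 1/200` and a test function
`f ∈ C^N` (`l + 2 ≤ N`) with `L₁₂(f)(0) = 0`, with integrability; `C_l` depends on `l` only. [cite: Elgindi2021, §6.3 proof of Proposition 6.13 (p. 18 of arXiv:1904.04795); ElgindiGhoulMasmoudi2021, §3.1 proof of Proposition 3.2 (p. 10 of arXiv:1910.14071)] -/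
theorem exists_integral_sq_iterate_Dz₁_nlRad₁_le (l : ℕ) : ∃ C, 0 ≤ C ∧ ∀ α : ℝ, 0 ≤ α → α ≤ 1 / 200 →
    ∀ (f : ℝ → ℝ → ℝ) (N : ℕ), ContDiff ℝ N (uncurry f) → HasCompactSupport (uncurry f) →
    tsupport (uncurry f) ⊆ strip → L12 f 0 = 0 → l + 2 ≤ N →
      IntegrableOn (fun z => Dz₁^[l] (nlRad₁ α f) z ^ 2 * radialWeight z ^ 2) (Ioi 0) ∧
      ∫ z in Ioi 0, Dz₁^[l] (nlRad₁ α f) z ^ 2 * radialWeight z ^ 2 ≤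
        C * ((∫ p in strip, (f p.1 p.2 * radialWeight p.1) ^ 2) +
          ∑ b ∈ range l, ∫ p in strip, (Dz^[b] f p.1 p.2 * radialWeight p.1) ^ 2) := by
  obtain ⟨C₁, hC₁0, hC₁⟩ := exists_abs_iterate_Dz₁_nlRad₁_le l
  refine ⟨C₁ ^ 2 * (l + 1) * (9 * π / 8), by positivity, ?_⟩
  intro α hα hα' f N hf hs hsub hL0 hlN
  -- the moments `M_m = D_z^m L₁₂(f)` and their `L²(dz/z²)` bounds
  set A : ℕ → ℝ := fun m => if m = 0 then ∫ p in strip, (f p.1 p.2 * radialWeight p.1) ^ 2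
    else ∫ p in strip, (Dz^[m - 1] f p.1 p.2 * radialWeight p.1) ^ 2 with hA
  have hM : ∀ m ≤ l, Integrable (fun z : ℝ => 1 / z ^ 2 * Dz₁^[m] (L12 f) z ^ 2) ∧
      ∫ z, 1 / z ^ 2 * Dz₁^[m] (L12 f) z ^ 2 ≤ 9 * π / 8 * A m := fun m hm =>
    integral_sq_iterate_Dz₁_L12_div_sq_le hf hs hsub hL0 (by omega)
  have hA0 : ∀ m, 0 ≤ A m := fun m => by
    simp only [hA]; split_ifs <;> exact integral_nonneg fun p => sq_nonneg _
  -- the dominating function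
  set G : ℝ → ℝ := fun z => C₁ ^ 2 * (l + 1) * ∑ b ∈ range (l + 1), 1 / z ^ 2 * Dz₁^[l - b] (L12 f) z ^ 2 with hG
  have iG : Integrable G := by
    refine (integrable_finsetSum _ fun b hb => ?_).const_mul _
    exact (hM (l - b) (Nat.sub_le l b)).1
  -- the pointwise bound on `z > 0`
  have hpt : ∀ z ∈ Ioi (0 : ℝ), Dz₁^[l] (nlRad₁ α f) z ^ 2 * radialWeight z ^ 2 ≤ G z := by
    intro z hz
    have hz0 : (0 : ℝ) < z := hz
    have hb := hC₁ α hα hα' f N hf hs hsub (by omega) z hz0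
    set T : ℝ := ∑ b ∈ range (l + 1), |Dz₁^[l - b] (L12 f) z| with hT
    have hT0 : 0 ≤ T := Finset.sum_nonneg fun b _ => abs_nonneg _
    have h1 : Dz₁^[l] (nlRad₁ α f) z ^ 2 ≤ (C₁ * (z / (1 + z) ^ 2) * T) ^ 2 := by
      rw [← sq_abs]; exact pow_le_pow_left₀ (abs_nonneg _) hb 2
    have hw : (z / (1 + z) ^ 2) ^ 2 * radialWeight z ^ 2 = 1 / z ^ 2 := by
      unfold radialWeight
      field_simp
    have hCS : T ^ 2 ≤ (l + 1) * ∑ b ∈ range (l + 1), |Dz₁^[l - b] (L12 f) z| ^ 2 := by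
      have h := sq_sum_le_card_mul_sum_sq (s := range (l + 1)) (f := fun b => |Dz₁^[l - b] (L12 f) z|)
      simp only [Finset.card_range, Nat.cast_add, Nat.cast_one] at h
      exact h
    calc Dz₁^[l] (nlRad₁ α f) z ^ 2 * radialWeight z ^ 2
        ≤ (C₁ * (z / (1 + z) ^ 2) * T) ^ 2 * radialWeight z ^ 2 :=
          mul_le_mul_of_nonneg_right h1 (sq_nonneg _)
      _ = C₁ ^ 2 * ((z / (1 + z) ^ 2) ^ 2 * radialWeight z ^ 2) * T ^ 2 := by ring
      _ = C₁ ^ 2 * (1 / z ^ 2) * T ^ 2 := by rw [hw]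
      _ ≤ C₁ ^ 2 * (1 / z ^ 2) * ((l + 1) * ∑ b ∈ range (l + 1), |Dz₁^[l - b] (L12 f) z| ^ 2) :=
          mul_le_mul_of_nonneg_left hCS (by positivity)
      _ = G z := by
          simp only [hG, sq_abs, Finset.mul_sum]
          refine Finset.sum_congr rfl fun b _ => ?_
          ring
  -- measurability on `(0, ∞)`
  have hSc : ContDiffOn ℝ 0 (Dz₁^[l] (nlRad₁ α f)) (Ioi 0) :=
    contDiffOn_iterate_Dz₁_Ioi (contDiffOn_nlRad₁ α hf hs hsub) (by omega)
  have hwc : ContinuousOn radialWeight (Ioi 0) := by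
    unfold radialWeight
    exact ContinuousOn.div (by fun_prop) (by fun_prop) fun z hz => pow_ne_zero 2 (ne_of_gt hz)
  have hm : AEStronglyMeasurable (fun z => Dz₁^[l] (nlRad₁ α f) z ^ 2 * radialWeight z ^ 2) (volume.restrict (Ioi 0)) :=
    ((hSc.continuousOn.pow 2).mul (hwc.pow 2)).aestronglyMeasurable measurableSet_Ioi
  have hint : IntegrableOn (fun z => Dz₁^[l] (nlRad₁ α f) z ^ 2 * radialWeight z ^ 2) (Ioi 0) := by
    refine Integrable.mono' iG.integrableOn hm ?_
    rw [ae_restrict_iff' measurableSet_Ioi]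
    refine Filter.Eventually.of_forall fun z hz => ?_
    rw [Real.norm_eq_abs, abs_of_nonneg (mul_nonneg (sq_nonneg _) (sq_nonneg _))]
    exact hpt z hz
  refine ⟨hint, ?_⟩
  have hG0 : 0 ≤ᵐ[volume] G := Filter.Eventually.of_forall fun z => by
    simp only [hG, Pi.zero_apply]
    exact mul_nonneg (by positivity) (Finset.sum_nonneg fun b _ => by positivity)
  have hIG : ∫ z, G z ≤ C₁ ^ 2 * (l + 1) * ∑ b ∈ range (l + 1), 9 * π / 8 * A (l - b) := by
    simp only [hG]
    rw [integral_const_mul, integral_finsetSum _ fun b hb => (hM (l - b) (Nat.sub_le l b)).1]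
    refine mul_le_mul_of_nonneg_left (Finset.sum_le_sum fun b _ => (hM (l - b) (Nat.sub_le l b)).2) (by positivity)
  -- reindex `b ↦ l - b`
  have hre : ∑ b ∈ range (l + 1), 9 * π / 8 * A (l - b) = 9 * π / 8 * ((∫ p in strip, (f p.1 p.2 * radialWeight p.1) ^ 2) +
      ∑ b ∈ range l, ∫ p in strip, (Dz^[b] f p.1 p.2 * radialWeight p.1) ^ 2) := by
    have hrefl : ∑ b ∈ range (l + 1), A (l - b) = ∑ m ∈ range (l + 1), A m := by
      have h := Finset.sum_range_reflect A (l + 1)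
      simpa using h
    rw [← Finset.mul_sum, hrefl, Finset.sum_range_succ']
    simp only [hA, Nat.succ_ne_zero, if_false, if_true, Nat.add_sub_cancel]
    ring
  calc ∫ z in Ioi 0, Dz₁^[l] (nlRad₁ α f) z ^ 2 * radialWeight z ^ 2
      ≤ ∫ z in Ioi 0, G z := setIntegral_mono_on hint iG.integrableOn measurableSet_Ioi hpt
    _ ≤ ∫ z, G z := setIntegral_le_integral iG hG0
    _ ≤ C₁ ^ 2 * (l + 1) * ∑ b ∈ range (l + 1), 9 * π / 8 * A (l - b) := hIG
    _ = C₁ ^ 2 * (l + 1) * (9 * π / 8) * ((∫ p in strip, (f p.1 p.2 * radialWeight p.1) ^ 2) +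
          ∑ b ∈ range l, ∫ p in strip, (Dz^[b] f p.1 p.2 * radialWeight p.1) ^ 2) := by rw [hre]; ring

/-! ### The projector factor `S₂` -/

/-- **`∫₀^∞(D_z^lS₂)²w² ≤ C_l∬(fw)²`** for `0 ≤ α ≤ 1/200` and a test function `f ∈ C²`, with
integrability; `C_l` depends on `l` only (`ℓ₀(f)² ≤ 153∬(fw)²`, `∫₀^∞(1+z)⁻² = 1`). [cite: Elgindi2021, §6.1 proof of Proposition 6.5 (the bound on L₁₂((3/(1+z))D_θf)(0)) and §6.3 (pp. 16, 18 of arXiv:1904.04795)] -/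
theorem exists_integral_sq_iterate_Dz₁_nlRad₂_le (l : ℕ) : ∃ C, 0 ≤ C ∧ ∀ α : ℝ, 0 ≤ α → α ≤ 1 / 200 →
    ∀ (f : ℝ → ℝ → ℝ), ContDiff ℝ 2 (uncurry f) → HasCompactSupport (uncurry f) →
    tsupport (uncurry f) ⊆ strip →
      IntegrableOn (fun z => Dz₁^[l] (nlRad₂ α f) z ^ 2 * radialWeight z ^ 2) (Ioi 0) ∧
      ∫ z in Ioi 0, Dz₁^[l] (nlRad₂ α f) z ^ 2 * radialWeight z ^ 2 ≤
        C * ∫ p in strip, (f p.1 p.2 * radialWeight p.1) ^ 2 := by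
  obtain ⟨C₂, hC₂0, hC₂⟩ := exists_abs_iterate_Dz₁_nlRad₂_le l
  refine ⟨C₂ ^ 2 * 153, by positivity, ?_⟩
  intro α hα hα' f hf hs hsub
  set ℓ₀ : ℝ := L12 (fun z θ => 3 / (1 + z) * Dθ f z θ) 0 with hℓ₀
  have hℓ : ℓ₀ ^ 2 ≤ 153 * ∫ p in strip, (f p.1 p.2 * radialWeight p.1) ^ 2 := sq_L12_transport_le_sq_norm hf hs hsub
  set G : ℝ → ℝ := fun z => C₂ ^ 2 * ℓ₀ ^ 2 * ((1 + z) ^ 2)⁻¹ with hG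
  have iG : IntegrableOn G (Ioi 0) := integrableOn_inv_one_add_sq.const_mul _
  have hpt : ∀ z ∈ Ioi (0 : ℝ), Dz₁^[l] (nlRad₂ α f) z ^ 2 * radialWeight z ^ 2 ≤ G z := by
    intro z hz
    have hz0 : (0 : ℝ) < z := hz
    have hb := hC₂ α hα hα' f z hz0.le
    have h1 : Dz₁^[l] (nlRad₂ α f) z ^ 2 ≤ (C₂ * |ℓ₀| * (z ^ 2 / (1 + z) ^ 3)) ^ 2 := by
      rw [← sq_abs]; exact pow_le_pow_left₀ (abs_nonneg _) hb 2
    have hw : (z ^ 2 / (1 + z) ^ 3) ^ 2 * radialWeight z ^ 2 = ((1 + z) ^ 2)⁻¹ := by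
      unfold radialWeight
      field_simp
    calc Dz₁^[l] (nlRad₂ α f) z ^ 2 * radialWeight z ^ 2
        ≤ (C₂ * |ℓ₀| * (z ^ 2 / (1 + z) ^ 3)) ^ 2 * radialWeight z ^ 2 := mul_le_mul_of_nonneg_right h1 (sq_nonneg _)
      _ = C₂ ^ 2 * |ℓ₀| ^ 2 * ((z ^ 2 / (1 + z) ^ 3) ^ 2 * radialWeight z ^ 2) := by ring
      _ = G z := by rw [hw, sq_abs]
  have hSc : ContDiffOn ℝ 0 (Dz₁^[l] (nlRad₂ α f)) (Ioi 0) :=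
    contDiffOn_iterate_Dz₁_Ioi (N := l) (contDiffOn_nlRad₂ α f _) (by omega)
  have hwc : ContinuousOn radialWeight (Ioi 0) := by
    unfold radialWeight
    exact ContinuousOn.div (by fun_prop) (by fun_prop) fun z hz => pow_ne_zero 2 (ne_of_gt hz)
  have hm : AEStronglyMeasurable (fun z => Dz₁^[l] (nlRad₂ α f) z ^ 2 * radialWeight z ^ 2) (volume.restrict (Ioi 0)) :=
    ((hSc.continuousOn.pow 2).mul (hwc.pow 2)).aestronglyMeasurable measurableSet_Ioi
  have hint : IntegrableOn (fun z => Dz₁^[l] (nlRad₂ α f) z ^ 2 * radialWeight z ^ 2) (Ioi 0) := by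
    refine Integrable.mono' iG hm ?_
    rw [ae_restrict_iff' measurableSet_Ioi]
    refine Filter.Eventually.of_forall fun z hz => ?_
    rw [Real.norm_eq_abs, abs_of_nonneg (mul_nonneg (sq_nonneg _) (sq_nonneg _))]
    exact hpt z hz
  refine ⟨hint, ?_⟩
  have hA0 : 0 ≤ ∫ p in strip, (f p.1 p.2 * radialWeight p.1) ^ 2 := integral_nonneg fun p => sq_nonneg _
  calc ∫ z in Ioi 0, Dz₁^[l] (nlRad₂ α f) z ^ 2 * radialWeight z ^ 2
      ≤ ∫ z in Ioi 0, G z := setIntegral_mono_on hint iG measurableSet_Ioi hpt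
    _ = C₂ ^ 2 * ℓ₀ ^ 2 := by
        simp only [hG]
        rw [integral_const_mul, integral_Ioi_inv_one_add_sq, mul_one]
    _ ≤ C₂ ^ 2 * (153 * ∫ p in strip, (f p.1 p.2 * radialWeight p.1) ^ 2) := mul_le_mul_of_nonneg_left hℓ (sq_nonneg _)
    _ = C₂ ^ 2 * 153 * ∫ p in strip, (f p.1 p.2 * radialWeight p.1) ^ 2 := by ring

end Elgindi

end Literature.Analysis.FluidPDE
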